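import Summits.AtomisticToContinuum.BoseEinsteinCondensation.Theses.BECBoundaryReservoir

/-!
# Crux `ShellPenetration` (stmt-AtomisticToContinuum-8767) — line `dichotomy` (strategist, 2026-08-17)

Alternative skeleton for the rank-2 crux of route `route-AtomisticToContinuum-BECBoundaryReservoir`, published
UNREGISTERED next to the live birth skeleton `Lines/birth.lean` (the CLI's `ledger skeleton check` has no
`--alt` and would replace birth's stub registration; the lead may register this file at a cycle boundary).

## The cut: IDEAL | INTERACTING, then the window

`IsRepulsiveFiniteRange v` admits the ideal gas (`v = 0` a.e. on `(0,∞)`), where the crux is a ONE-BODY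
statement about `h = −Δ_D − κ|g⟩⟨g|` that holds only at the resonant pinning `κ = 3/w²` (item stamps g44-2,
g45-36, rattack-8767-0; numerics of this seat, kit j023270: `θ_L = E₀L² → 8.59`, shell occupation
`⟨g,φ₀⟩²L/w → 1.70`, `min_z L³(∫_{B(z,1)}φ₀)² ↓ 11.6 > 0` over the admissible centres — the corner HOLDS).
Every stub of the birth line has this `v ≡ 0` sub-case and hence needs the (unbuilt) spectral analysis of the
cube at resonance. This line factors it out ONCE:

* `stub_idealResonance` — the crux verbatim for `volume {r > 0 | v r ≠ 0} = 0` (one-body spectral theory: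
  rank-one perturbation of the Dirichlet Laplacian at resonance, resolvent asymptotics to order `w³/L` with
  edges and corners, resolvent positivity below `λ₁`, near-minimiser reduction via the one-body gap `≍ L⁻²`);
* `stub_interactingWindow` — for `volume {r > 0 | v r ≠ 0} ≠ 0` (⇔ positive scattering length) the pinning
  fills the shell at bounded density, `θ|S_w| ≤ ⟨g,γ_Ψ g⟩ ≤ Θ|S_w|` eventually for near-minimisers
  (variational: trial state + concavity in `κ` for the floor, local Lieb–Yngvason bound in the slab for the
  ceiling; no resonance analysis needed once `a > 0`);
* `stub_interactingPenetration` — for interacting `v` and EVERY window: windowed near-minimisers carry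
  `c⟨g,γ_Ψ g⟩ ≤ |⟨1_{B(z,1)},γ_Ψ g⟩|²` to every admissible ball (the open ODLRO content; birth's
  `stub_bulkLocking` + `stub_localEquipartition` restricted to `a > 0` prove it as stated, and so would the
  existence/rigidity cut `PinnedBEC` + `CondensateRigidity` recorded in `STRATEGY-CENSUS.md`).

Composition `shellPenetration_of_stubs` (kernel-checked, no `sorry` of its own): `by_cases` on the null set;
ideal case = stub 1; else `ρ₀ := min`, window parameters from stub 2, `c` from stub 3 fed the window, slack
`min δ δ'`, positivity of the occupation from the floor and `0 < θ(L³ − (L−2w)³)`. `ShellPenetration_of` is the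
ONLY theorem concluding the crux by name. The same three statements are the children of the route-level split
prepared by this seat (`split/children.json`; `route edit --split` is final-cycle-only and was not applied).

Disproof used: none exists for this crux. Refuter evidence honoured: the case predicate is the Lebesgue measure
of `{r > 0 | v r ≠ 0}` (so `v` supported on `r ≤ 0`, or `⊤` on a null set of radii — both energetically ideal —
land on the IDEAL side), and stub 1 keeps `∃ κ` (the resonance). Negatives index (20 items; BEC: SwapJensen
stmt-3980, BerryStiffPhaseLRO stmt-14490): disjoint vocabulary.
-/

noncomputable section

open MeasureTheory Filter
open scoped ENNReal NNReal ComplexConjugate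

namespace Summit.AtomisticToContinuum.BoseEinsteinCondensation.Cruxes.ShellPenetration.Dichotomy

open Literature.MathematicalPhysics.QuantumManyBody.BoseGas

/-! ## Stubs (statements inlined over `BoseGas.{IsRepulsiveFiniteRange, sideLength, TrialState, energy,
occupation}` and Mathlib; identical to the children `IdealShellResonance`, `InteractingShellWindow`,
`InteractingWindowPenetration` of the prepared route-level split) -/

/-- **Stub 1 — the ideal-gas corner at resonance.** For `v = 0` a.e. on `(0,∞)` the crux statement verbatim
(expected witness `w = 1`, `κ = 3/w²`, `c ≈ 11ρ`; kit j023270). Size L (paper) / XL (Lean). -/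
theorem stub_idealResonance :
    ∀ v : ℝ → ENNReal, Literature.MathematicalPhysics.QuantumManyBody.BoseGas.IsRepulsiveFiniteRange v → MeasureTheory.volume {r : ℝ | 0 < r ∧ v r ≠ 0} = 0 → ∃ ρ₀ : ℝ, 0 < ρ₀ ∧ ∀ ρ : ℝ, 0 < ρ → ρ < ρ₀ → ∃ w κ c : ℝ, 0 < w ∧ 0 < κ ∧ 0 < c ∧ ∀ᶠ n : ℕ in Filter.atTop, ∃ δ : ENNReal, 0 < δ ∧ let L : ℝ := Literature.MathematicalPhysics.QuantumManyBody.BoseGas.sideLength ρ (n + 1); let g : EuclideanSpace ℝ (Fin 3) → ℂ := Set.indicator {x | (∀ k, x k ∈ Set.Ioo 0 L) ∧ ∃ k, x k ≤ w ∨ L - w ≤ x k} (fun _ => ((Real.sqrt (L ^ 3 - (L - 2 * w) ^ 3))⁻¹ : ℂ)); ∀ Ψ : Literature.MathematicalPhysics.QuantumManyBody.BoseGas.TrialState (n + 1) L, Literature.MathematicalPhysics.QuantumManyBody.BoseGas.energy v Ψ + ENNReal.ofReal κ * ((n + 1 : ENNReal) - Literature.MathematicalPhysics.QuantumManyBody.BoseGas.occupation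 (n + 1) g Ψ.ψ) ≤ (⨅ Φ : Literature.MathematicalPhysics.QuantumManyBody.BoseGas.TrialState (n + 1) L, Literature.MathematicalPhysics.QuantumManyBody.BoseGas.energy v Φ + ENNReal.ofReal κ * ((n + 1 : ENNReal) - Literature.MathematicalPhysics.QuantumManyBody.BoseGas.occupation (n + 1) g Φ.ψ)) + δ → 0 < Literature.MathematicalPhysics.QuantumManyBody.BoseGas.occupation (n + 1) g Ψ.ψ ∧ ∀ z : EuclideanSpace ℝ (Fin 3), (∀ k, z k ∈ Set.Icc (2 * w + 1) (L - 2 * w - 1)) → c * (Literature.MathematicalPhysics.QuantumManyBody.BoseGas.occupation (n + 1) g Ψ.ψ).toReal ≤ ‖(n + 1 : ℂ) * ∫ Y : Fin n → EuclideanSpace ℝ (Fin 3), (∫ x in Metric.ball z 1, Ψ.ψ (Matrix.vecCons x Y)) * conj (∫ x, conj (g x) * Ψ.ψ (Matrix.vecCons x Y))‖ ^ 2 := by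
  sorry

/-- **Stub 2 — reservoir window for the interacting gas.** For `v` non-zero on a set of positive measure of
radii there is `ρ₀ > 0` such that for `0 < ρ < ρ₀` some `(w, κ, θ, Θ)` put the near-minimisers' shell
occupation in `[θ|S_w|, Θ|S_w|]` eventually (`|S_w| = L³ − (L−2w)³`). Variational; size M–L. -/
theorem stub_interactingWindow :
    ∀ v : ℝ → ENNReal, Literature.MathematicalPhysics.QuantumManyBody.BoseGas.IsRepulsiveFiniteRange v → MeasureTheory.volume {r : ℝ | 0 < r ∧ v r ≠ 0} ≠ 0 → ∃ ρ₀ : ℝ, 0 < ρ₀ ∧ ∀ ρ : ℝ, 0 < ρ → ρ < ρ₀ → ∃ w κ θ Θ : ℝ, 0 < w ∧ 0 < κ ∧ 0 < θ ∧ ∀ᶠ n : ℕ in Filter.atTop, ∃ δ : ENNReal, 0 < δ ∧ let L : ℝ := Literature.MathematicalPhysics.QuantumManyBody.BoseGas.sideLength ρ (n + 1); let g : EuclideanSpace ℝ (Fin 3) → ℂ := Set.indicator {x | (∀ k, x k ∈ Set.Ioo 0 L) ∧ ∃ k, x k ≤ w ∨ L - w ≤ x k} (fun _ => ((Real.sqrt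 (L ^ 3 - (L - 2 * w) ^ 3))⁻¹ : ℂ)); ∀ Ψ : Literature.MathematicalPhysics.QuantumManyBody.BoseGas.TrialState (n + 1) L, Literature.MathematicalPhysics.QuantumManyBody.BoseGas.energy v Ψ + ENNReal.ofReal κ * ((n + 1 : ENNReal) - Literature.MathematicalPhysics.QuantumManyBody.BoseGas.occupation (n + 1) g Ψ.ψ) ≤ (⨅ Φ : Literature.MathematicalPhysics.QuantumManyBody.BoseGas.TrialState (n + 1) L, Literature.MathematicalPhysics.QuantumManyBody.BoseGas.energy v Φ + ENNReal.ofReal κ * ((n + 1 : ENNReal) - Literature.MathematicalPhysics.QuantumManyBody.BoseGas.occupation (n + 1) g Φ.ψ)) + δ → ENNReal.ofReal (θ * (L ^ 3 - (L - 2 * w) ^ 3)) ≤ Literature.MathematicalPhysics.QuantumManyBody.BoseGas.occupation (n + 1) g Ψ.ψ ∧ Literature.MathematicalPhysics.QuantumManyBody.BoseGas.occupation (n + 1) g Ψ.ψ ≤ ENNReal.ofReal (Θ * (L ^ 3 - (L - 2 * w) ^ 3)) := by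
  sorry

/-- **Stub 3 — windowed reservoir ⇒ penetration, interacting gas (the open content).** For interacting `v`,
small `ρ` and EVERY `(w, κ, θ, Θ)`: an eventual window for the near-minimisers forces `c > 0` with
`c⟨g,γ_Ψ g⟩ ≤ |⟨1_{B(z,1)},γ_Ψ g⟩|²` on every admissible unit ball, eventually. Open-problem size. -/
theorem stub_interactingPenetration :
    ∀ v : ℝ → ENNReal, Literature.MathematicalPhysics.QuantumManyBody.BoseGas.IsRepulsiveFiniteRange v → MeasureTheory.volume {r : ℝ | 0 < r ∧ v r ≠ 0} ≠ 0 → ∃ ρ₀ : ℝ, 0 < ρ₀ ∧ ∀ ρ : ℝ, 0 < ρ → ρ < ρ₀ → ∀ w κ θ Θ : ℝ, 0 < w → 0 < κ → 0 < θ → (∀ᶠ n : ℕ in Filter.atTop, ∃ δ : ENNReal, 0 < δ ∧ let L : ℝ := Literature.MathematicalPhysics.QuantumManyBody.BoseGas.sideLength ρ (n + 1); let g : EuclideanSpace ℝ (Fin 3) → ℂ := Set.indicator {x | (∀ k, x k ∈ Set.Ioo 0 L) ∧ ∃ k, x k ≤ w ∨ L - w ≤ x k} (fun _ => ((Real.sqrt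 (L ^ 3 - (L - 2 * w) ^ 3))⁻¹ : ℂ)); ∀ Ψ : Literature.MathematicalPhysics.QuantumManyBody.BoseGas.TrialState (n + 1) L, Literature.MathematicalPhysics.QuantumManyBody.BoseGas.energy v Ψ + ENNReal.ofReal κ * ((n + 1 : ENNReal) - Literature.MathematicalPhysics.QuantumManyBody.BoseGas.occupation (n + 1) g Ψ.ψ) ≤ (⨅ Φ : Literature.MathematicalPhysics.QuantumManyBody.BoseGas.TrialState (n + 1) L, Literature.MathematicalPhysics.QuantumManyBody.BoseGas.energy v Φ + ENNReal.ofReal κ * ((n + 1 : ENNReal) - Literature.MathematicalPhysics.QuantumManyBody.BoseGas.occupation (n + 1) g Φ.ψ)) + δ → ENNReal.ofReal (θ * (L ^ 3 - (L - 2 * w) ^ 3)) ≤ Literature.MathematicalPhysics.QuantumManyBody.BoseGas.occupation (n + 1) g Ψ.ψ ∧ Literature.MathematicalPhysics.QuantumManyBody.BoseGas.occupation (n + 1) g Ψ.ψ ≤ ENNReal.ofReal (Θ * (L ^ 3 - (L - 2 * w) ^ 3))) → ∃ c : ℝ, 0 < c ∧ ∀ᶠ n : ℕ in Filter.atTop,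 ∃ δ : ENNReal, 0 < δ ∧ let L : ℝ := Literature.MathematicalPhysics.QuantumManyBody.BoseGas.sideLength ρ (n + 1); let g : EuclideanSpace ℝ (Fin 3) → ℂ := Set.indicator {x | (∀ k, x k ∈ Set.Ioo 0 L) ∧ ∃ k, x k ≤ w ∨ L - w ≤ x k} (fun _ => ((Real.sqrt (L ^ 3 - (L - 2 * w) ^ 3))⁻¹ : ℂ)); ∀ Ψ : Literature.MathematicalPhysics.QuantumManyBody.BoseGas.TrialState (n + 1) L, Literature.MathematicalPhysics.QuantumManyBody.BoseGas.energy v Ψ + ENNReal.ofReal κ * ((n + 1 : ENNReal) - Literature.MathematicalPhysics.QuantumManyBody.BoseGas.occupation (n + 1) g Ψ.ψ) ≤ (⨅ Φ : Literature.MathematicalPhysics.QuantumManyBody.BoseGas.TrialState (n + 1) L, Literature.MathematicalPhysics.QuantumManyBody.BoseGas.energy v Φ + ENNReal.ofReal κ * ((n + 1 : ENNReal) - Literature.MathematicalPhysics.QuantumManyBody.BoseGas.occupation (n + 1) g Φ.ψ)) + δ → ∀ z : EuclideanSpace ℝ (Fin 3), (∀ k, z k ∈ Set.Icc (2 * w +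 1) (L - 2 * w - 1)) → c * (Literature.MathematicalPhysics.QuantumManyBody.BoseGas.occupation (n + 1) g Ψ.ψ).toReal ≤ ‖(n + 1 : ℂ) * ∫ Y : Fin n → EuclideanSpace ℝ (Fin 3), (∫ x in Metric.ball z 1, Ψ.ψ (Matrix.vecCons x Y)) * conj (∫ x, conj (g x) * Ψ.ψ (Matrix.vecCons x Y))‖ ^ 2 := by
  sorry

/-! ## Composition (kernel-checked, no `sorry` of its own) -/

/-- The three stub statements imply the crux statement (conclusion = the body of
`Theses.BECBoundaryReservoir.ShellPenetration` verbatim, so that `ShellPenetration_of` below is the only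
theorem of the file concluding the crux by name). [folklore] -/
theorem shellPenetration_of_stubs
    (h₁ : ∀ v : ℝ → ENNReal, Literature.MathematicalPhysics.QuantumManyBody.BoseGas.IsRepulsiveFiniteRange v → MeasureTheory.volume {r : ℝ | 0 < r ∧ v r ≠ 0} = 0 → ∃ ρ₀ : ℝ, 0 < ρ₀ ∧ ∀ ρ : ℝ, 0 < ρ → ρ < ρ₀ → ∃ w κ c : ℝ, 0 < w ∧ 0 < κ ∧ 0 < c ∧ ∀ᶠ n : ℕ in Filter.atTop, ∃ δ : ENNReal, 0 < δ ∧ let L : ℝ := Literature.MathematicalPhysics.QuantumManyBody.BoseGas.sideLength ρ (n + 1); let g : EuclideanSpace ℝ (Fin 3) → ℂ := Set.indicator {x | (∀ k, x k ∈ Set.Ioo 0 L) ∧ ∃ k, x k ≤ w ∨ L - w ≤ x k} (fun _ => ((Real.sqrt (L ^ 3 - (L - 2 * w) ^ 3))⁻¹ : ℂ)); ∀ Ψ : Literature.MathematicalPhysics.QuantumManyBody.BoseGas.TrialState (n + 1) L, Literature.MathematicalPhysics.QuantumManyBody.BoseGas.energy v Ψ + ENNReal.ofReal κ * ((n + 1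 : ENNReal) - Literature.MathematicalPhysics.QuantumManyBody.BoseGas.occupation (n + 1) g Ψ.ψ) ≤ (⨅ Φ : Literature.MathematicalPhysics.QuantumManyBody.BoseGas.TrialState (n + 1) L, Literature.MathematicalPhysics.QuantumManyBody.BoseGas.energy v Φ + ENNReal.ofReal κ * ((n + 1 : ENNReal) - Literature.MathematicalPhysics.QuantumManyBody.BoseGas.occupation (n + 1) g Φ.ψ)) + δ → 0 < Literature.MathematicalPhysics.QuantumManyBody.BoseGas.occupation (n + 1) g Ψ.ψ ∧ ∀ z : EuclideanSpace ℝ (Fin 3), (∀ k, z k ∈ Set.Icc (2 * w + 1) (L - 2 * w - 1)) → c * (Literature.MathematicalPhysics.QuantumManyBody.BoseGas.occupation (n + 1) g Ψ.ψ).toReal ≤ ‖(n + 1 : ℂ) * ∫ Y : Fin n → EuclideanSpace ℝ (Fin 3), (∫ x in Metric.ball z 1, Ψ.ψ (Matrix.vecCons x Y)) * conj (∫ x, conj (g x) * Ψ.ψ (Matrix.vecCons x Y))‖ ^ 2)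
    (h₂ : ∀ v : ℝ → ENNReal, Literature.MathematicalPhysics.QuantumManyBody.BoseGas.IsRepulsiveFiniteRange v → MeasureTheory.volume {r : ℝ | 0 < r ∧ v r ≠ 0} ≠ 0 → ∃ ρ₀ : ℝ, 0 < ρ₀ ∧ ∀ ρ : ℝ, 0 < ρ → ρ < ρ₀ → ∃ w κ θ Θ : ℝ, 0 < w ∧ 0 < κ ∧ 0 < θ ∧ ∀ᶠ n : ℕ in Filter.atTop, ∃ δ : ENNReal, 0 < δ ∧ let L : ℝ := Literature.MathematicalPhysics.QuantumManyBody.BoseGas.sideLength ρ (n + 1); let g : EuclideanSpace ℝ (Fin 3) → ℂ := Set.indicator {x | (∀ k, x k ∈ Set.Ioo 0 L) ∧ ∃ k, x k ≤ w ∨ L - w ≤ x k} (fun _ => ((Real.sqrt (L ^ 3 - (L - 2 * w) ^ 3))⁻¹ : ℂ)); ∀ Ψ : Literature.MathematicalPhysics.QuantumManyBody.BoseGas.TrialState (n + 1) L, Literature.MathematicalPhysics.QuantumManyBody.BoseGas.energy v Ψ + ENNReal.ofReal κ * ((n + 1 : ENNReal) - Literature.MathematicalPhysics.QuantumManyBody.BoseGas.occupation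 (n + 1) g Ψ.ψ) ≤ (⨅ Φ : Literature.MathematicalPhysics.QuantumManyBody.BoseGas.TrialState (n + 1) L, Literature.MathematicalPhysics.QuantumManyBody.BoseGas.energy v Φ + ENNReal.ofReal κ * ((n + 1 : ENNReal) - Literature.MathematicalPhysics.QuantumManyBody.BoseGas.occupation (n + 1) g Φ.ψ)) + δ → ENNReal.ofReal (θ * (L ^ 3 - (L - 2 * w) ^ 3)) ≤ Literature.MathematicalPhysics.QuantumManyBody.BoseGas.occupation (n + 1) g Ψ.ψ ∧ Literature.MathematicalPhysics.QuantumManyBody.BoseGas.occupation (n + 1) g Ψ.ψ ≤ ENNReal.ofReal (Θ * (L ^ 3 - (L - 2 * w) ^ 3)))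
    (h₃ : ∀ v : ℝ → ENNReal, Literature.MathematicalPhysics.QuantumManyBody.BoseGas.IsRepulsiveFiniteRange v → MeasureTheory.volume {r : ℝ | 0 < r ∧ v r ≠ 0} ≠ 0 → ∃ ρ₀ : ℝ, 0 < ρ₀ ∧ ∀ ρ : ℝ, 0 < ρ → ρ < ρ₀ → ∀ w κ θ Θ : ℝ, 0 < w → 0 < κ → 0 < θ → (∀ᶠ n : ℕ in Filter.atTop, ∃ δ : ENNReal, 0 < δ ∧ let L : ℝ := Literature.MathematicalPhysics.QuantumManyBody.BoseGas.sideLength ρ (n + 1); let g : EuclideanSpace ℝ (Fin 3) → ℂ := Set.indicator {x | (∀ k, x k ∈ Set.Ioo 0 L) ∧ ∃ k, x k ≤ w ∨ L - w ≤ x k} (fun _ => ((Real.sqrt (L ^ 3 - (L - 2 * w) ^ 3))⁻¹ : ℂ)); ∀ Ψ : Literature.MathematicalPhysics.QuantumManyBody.BoseGas.TrialState (n + 1) L, Literature.MathematicalPhysics.QuantumManyBody.BoseGas.energy v Ψ + ENNReal.ofReal κ * ((n + 1 : ENNReal) - Literature.MathematicalPhysics.QuantumManyBody.BoseGas.occupation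 (n + 1) g Ψ.ψ) ≤ (⨅ Φ : Literature.MathematicalPhysics.QuantumManyBody.BoseGas.TrialState (n + 1) L, Literature.MathematicalPhysics.QuantumManyBody.BoseGas.energy v Φ + ENNReal.ofReal κ * ((n + 1 : ENNReal) - Literature.MathematicalPhysics.QuantumManyBody.BoseGas.occupation (n + 1) g Φ.ψ)) + δ → ENNReal.ofReal (θ * (L ^ 3 - (L - 2 * w) ^ 3)) ≤ Literature.MathematicalPhysics.QuantumManyBody.BoseGas.occupation (n + 1) g Ψ.ψ ∧ Literature.MathematicalPhysics.QuantumManyBody.BoseGas.occupation (n + 1) g Ψ.ψ ≤ ENNReal.ofReal (Θ * (L ^ 3 - (L - 2 * w) ^ 3))) → ∃ c : ℝ, 0 < c ∧ ∀ᶠ n : ℕ in Filter.atTop, ∃ δ : ENNReal, 0 < δ ∧ let L : ℝ := Literature.MathematicalPhysics.QuantumManyBody.BoseGas.sideLength ρ (n + 1); let g : EuclideanSpace ℝ (Fin 3) → ℂ := Set.indicator {x | (∀ k, x k ∈ Set.Ioo 0 L) ∧ ∃ k, x k ≤ w ∨ L - w ≤ x k} (fun _ => ((Real.sqrt (L ^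 3 - (L - 2 * w) ^ 3))⁻¹ : ℂ)); ∀ Ψ : Literature.MathematicalPhysics.QuantumManyBody.BoseGas.TrialState (n + 1) L, Literature.MathematicalPhysics.QuantumManyBody.BoseGas.energy v Ψ + ENNReal.ofReal κ * ((n + 1 : ENNReal) - Literature.MathematicalPhysics.QuantumManyBody.BoseGas.occupation (n + 1) g Ψ.ψ) ≤ (⨅ Φ : Literature.MathematicalPhysics.QuantumManyBody.BoseGas.TrialState (n + 1) L, Literature.MathematicalPhysics.QuantumManyBody.BoseGas.energy v Φ + ENNReal.ofReal κ * ((n + 1 : ENNReal) - Literature.MathematicalPhysics.QuantumManyBody.BoseGas.occupation (n + 1) g Φ.ψ)) + δ → ∀ z : EuclideanSpace ℝ (Fin 3), (∀ k, z k ∈ Set.Icc (2 * w + 1) (L - 2 * w - 1)) → c * (Literature.MathematicalPhysics.QuantumManyBody.BoseGas.occupation (n + 1) g Ψ.ψ).toReal ≤ ‖(n + 1 : ℂ) * ∫ Y : Fin n → EuclideanSpace ℝ (Fin 3), (∫ x in Metric.ball z 1, Ψ.ψ (Matrix.vecCons x Y)) * conj (∫ x, conj (g x) * Ψ.ψ (Matrix.vecCons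 x Y))‖ ^ 2) :
    ∀ v : ℝ → ENNReal, Literature.MathematicalPhysics.QuantumManyBody.BoseGas.IsRepulsiveFiniteRange v → ∃ ρ₀ : ℝ, 0 < ρ₀ ∧ ∀ ρ : ℝ, 0 < ρ → ρ < ρ₀ → ∃ w κ c : ℝ, 0 < w ∧ 0 < κ ∧ 0 < c ∧ ∀ᶠ n : ℕ in Filter.atTop, ∃ δ : ENNReal, 0 < δ ∧ let L : ℝ := Literature.MathematicalPhysics.QuantumManyBody.BoseGas.sideLength ρ (n + 1); let g : EuclideanSpace ℝ (Fin 3) → ℂ := Set.indicator {x | (∀ k, x k ∈ Set.Ioo 0 L) ∧ ∃ k, x k ≤ w ∨ L - w ≤ x k} (fun _ => ((Real.sqrt (L ^ 3 - (L - 2 * w) ^ 3))⁻¹ : ℂ)); ∀ Ψ : Literature.MathematicalPhysics.QuantumManyBody.BoseGas.TrialState (n + 1) L, Literature.MathematicalPhysics.QuantumManyBody.BoseGas.energy v Ψ + ENNReal.ofReal κ * ((n + 1 : ENNReal) - Literature.MathematicalPhysics.QuantumManyBody.BoseGas.occupation (n + 1) g Ψ.ψ) ≤ (⨅ Φ : Literature.MathematicalPhysics.QuantumManyBody.BoseGas.TrialState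 (n + 1) L, Literature.MathematicalPhysics.QuantumManyBody.BoseGas.energy v Φ + ENNReal.ofReal κ * ((n + 1 : ENNReal) - Literature.MathematicalPhysics.QuantumManyBody.BoseGas.occupation (n + 1) g Φ.ψ)) + δ → 0 < Literature.MathematicalPhysics.QuantumManyBody.BoseGas.occupation (n + 1) g Ψ.ψ ∧ ∀ z : EuclideanSpace ℝ (Fin 3), (∀ k, z k ∈ Set.Icc (2 * w + 1) (L - 2 * w - 1)) → c * (Literature.MathematicalPhysics.QuantumManyBody.BoseGas.occupation (n + 1) g Ψ.ψ).toReal ≤ ‖(n + 1 : ℂ) * ∫ Y : Fin n → EuclideanSpace ℝ (Fin 3), (∫ x in Metric.ball z 1, Ψ.ψ (Matrix.vecCons x Y)) * conj (∫ x, conj (g x) * Ψ.ψ (Matrix.vecCons x Y))‖ ^ 2 := by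
  intro v hv
  by_cases hid : MeasureTheory.volume {r : ℝ | 0 < r ∧ v r ≠ 0} = 0
  · exact h₁ v hv hid
  obtain ⟨ρW, hρW, hW⟩ := h₂ v hv hid
  obtain ⟨ρP, hρP, hP⟩ := h₃ v hv hid
  refine ⟨min ρW ρP, lt_min hρW hρP, fun ρ hρ hρlt => ?_⟩
  have hρltW : ρ < ρW := hρlt.trans_le (min_le_left _ _)
  have hρltP : ρ < ρP := hρlt.trans_le (min_le_right _ _)
  -- Child 2: the window, with its parameters.
  obtain ⟨w, κ, θ, Θ, hw, hκ, hθ, hevW⟩ := hW ρ hρ hρltW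
  -- Child 3: penetration, fed the window.
  obtain ⟨c, hc, hevP⟩ := hP ρ hρ hρltP w κ θ Θ hw hκ hθ hevW
  refine ⟨w, κ, c, hw, hκ, hc, ?_⟩
  -- Positivity of the shell volume `L³ − (L − 2w)³`.
  have hvol : ∀ L : ℝ, 0 < θ * (L ^ 3 - (L - 2 * w) ^ 3) := by
    intro L
    have hlt : (L - 2 * w) ^ 3 < L ^ 3 :=
      Odd.strictMono_pow (by decide : Odd 3) (by linarith : L - 2 * w < L)
    exact mul_pos hθ (sub_pos.mpr hlt)
  filter_upwards [hevW, hevP] with n hnW hnP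
  obtain ⟨δW, hδW, hnW⟩ := hnW
  obtain ⟨δP, hδP, hnP⟩ := hnP
  refine ⟨min δW δP, lt_min hδW hδP, ?_⟩
  intro L g Ψ hΨ
  have hΨW := hΨ.trans (add_le_add le_rfl (min_le_left δW δP))
  have hΨP := hΨ.trans (add_le_add le_rfl (min_le_right δW δP))
  obtain ⟨hlo, -⟩ := hnW Ψ hΨW
  refine ⟨lt_of_lt_of_le (ENNReal.ofReal_pos.mpr (hvol L)) hlo, ?_⟩
  exact hnP Ψ hΨP


/-- **`ShellPenetration` from the three stubs** — the crux BY NAME; the `sorry`s of the three stubs are the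
only ones in the file. [folklore] -/
theorem ShellPenetration_of : Theses.BECBoundaryReservoir.ShellPenetration :=
  shellPenetration_of_stubs stub_idealResonance stub_interactingWindow stub_interactingPenetration

end Summit.AtomisticToContinuum.BoseEinsteinCondensation.Cruxes.ShellPenetration.Dichotomy

end
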